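import Mathlib

/-!
# Endomorphisms of a perfect group that are the identity modulo the centre

Solo unit `solo-SmoothPoincare4-informed`, session 9 (HOME `paper/miyazawa-spheres.md`, Thm 9.5,
Step 1, second half): for `G = π₁(Σ(2,q,r))` (perfect, centre `ℤ`) the map
`Aut(G) → Aut(G / Z(G)) = Aut(Δ(2,q,r))` is injective.  The general fact proved here: if `G` is
perfect and an endomorphism `α` satisfies `g⁻¹ α(g) ∈ Z(G)` for all `g`, then `α = id` — because
`g ↦ g⁻¹ α(g)` is a homomorphism to the abelian group `Z(G)` and therefore kills `[G,G] = G`.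
-/

namespace Summit.SmoothPoincare4.SmoothPoincare4.Theorems
namespace PerfectProd

open Subgroup

variable {G : Type*} [Group G]

/-- The "difference cocycle" `g ↦ g⁻¹ α g` of an endomorphism that is the identity modulo the
centre is a homomorphism into the centre. -/
def centralDifference (α : G →* G) (hα : ∀ g, g⁻¹ * α g ∈ center G) : G →* center G where
  toFun g := ⟨g⁻¹ * α g, hα g⟩
  map_one' := by ext; simp
  map_mul' a b := by
    ext
    simp only [map_mul, mul_inv_rev, Subgroup.coe_mul]
    have hc := Subgroup.mem_center_iff.mp (hα a)
    calc b⁻¹ * a⁻¹ * (α a * α b) = b⁻¹ * (a⁻¹ * α a) * α b := by group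
      _ = (a⁻¹ * α a) * b⁻¹ * α b := by rw [hc b⁻¹]
      _ = a⁻¹ * α a * (b⁻¹ * α b) := by group

/-- The value of `centralDifference α hα` at `g`, as an element of `G`, is `g⁻¹ * α g`. -/
@[simp] theorem centralDifference_apply (α : G →* G) (hα : ∀ g, g⁻¹ * α g ∈ center G) (g : G) :
    ((centralDifference α hα g : center G) : G) = g⁻¹ * α g := rfl

/-- A perfect group admits no non-identity endomorphism that is the identity modulo the centre. -/
theorem eq_self_of_perfect_of_central_difference (hG : commutator G = ⊤) (α : G →* G)
    (hα : ∀ g, g⁻¹ * α g ∈ center G) (g : G) : α g = g := by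
  have hker : commutator G ≤ (centralDifference α hα).ker := by
    rw [commutator_def, Subgroup.commutator_le]
    intro a _ b _
    rw [MonoidHom.mem_ker, commutatorElement_def]
    apply Subtype.ext
    simp only [map_mul, map_inv, Subgroup.coe_mul, Subgroup.coe_inv, Subgroup.coe_one,
      centralDifference_apply]
    have hca := Subgroup.mem_center_iff.mp (hα a)
    rw [← hca (b⁻¹ * α b)]
    group
  have hg : g ∈ (centralDifference α hα).ker := hker (hG ▸ Subgroup.mem_top g)
  have h1 : g⁻¹ * α g = 1 := by
    have := congrArg (fun x : center G => (x : G)) (MonoidHom.mem_ker.mp hg)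
    simpa using this
  calc α g = g * (g⁻¹ * α g) := by group
    _ = g := by rw [h1, mul_one]

/-- Reformulation for automorphisms: an automorphism of a perfect group inducing the identity
on `G / Z(G)` is the identity. -/
theorem mulEquiv_eq_refl_of_perfect (hG : commutator G = ⊤) (α : G ≃* G)
    (hα : ∀ g, g⁻¹ * α g ∈ center G) : α = MulEquiv.refl G := by
  ext g
  exact eq_self_of_perfect_of_central_difference hG α.toMonoidHom hα g

end PerfectProd
end Summit.SmoothPoincare4.SmoothPoincare4.Theorems
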